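import Summits.RiemannHypothesis.RiemannHypothesis.Theses.LiTailLaguerre
import Summits.RiemannHypothesis.RiemannHypothesis.Theorems.LiTailLaguerrePolarTail
import Summits.RiemannHypothesis.RiemannHypothesis.Theorems.LiTailLaguerreTailAdjust
import Summits.RiemannHypothesis.RiemannHypothesis.Theorems.LiTailLaguerreLiTailContour
import Summits.RiemannHypothesis.RiemannHypothesis.Theorems.LiTailLaguerreLiTailHorizontal
import Summits.RiemannHypothesis.RiemannHypothesis.Theorems.LiPrimeEchoAssembly
import Summits.RiemannHypothesis.RiemannHypothesis.Theorems.LiPrimeEchoLawProof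
import Literature.NumberTheory.LFunctions.ZetaArgBacklundExplicit
import HarnessLib

/-!
# RiemannHypothesis / LiTailLaguerre — what the RUNG buys: TAIL SILENCE and the TAIL ECHO as compositions (RH-FREE)

RH-FREE [rh-li-eng-4].  Route `Theses/LiTailLaguerre.lean` (rung «Li TAIL–LAGUERRE LAW» `LiTheory.LiZeroTailLaguerre`,
L-P(P1-tail); cell `pub/rh-li`, theory round 7, dossier `theory/route/r7/`).  PART K (`Theorems/LiTailLaguerreDefs.lean`)
types two companions of the leaf: TAIL SILENCE `LiZeroTailSilent` (T3f₀: for `c ≥ 5/4` the zero tail above `c√n` IS its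
smooth counterpart up to `O(log² n)`) and the TAIL ECHO `LiZeroTailEcho` (T3f: the zeros above `√n` carry the FULL echo
`+E₂(n)` of the prime `2`), with PROVED glue `liZeroTailSilent_of : leaf → silent` and
`liZeroTailEcho_of : leaf → LiCoffeyTermFejer → echo`.  This module records two kernel-checked compositions:

* `liZeroTailSilent_of_rung`: **K3′ `LiGammaTailShift` + the BC5 RUNG `stub_rung_silent` of K2′ (`|liPrimeTail n T| ≤
  C log n` for `c ≥ 5/4`, `T ∈ [c√n, c√n + 1]`) ⇒ `LiZeroTailSilent`** — the half-strip contour identity K1′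
  (`liTailContour_proof`), the horizontal edge K4′ (`liTailHorizontal_proof`) and the Assembly supports `liPolarTailBound`,
  `liTailAdjust` are already tree theorems, so tail silence does NOT wait for the deciding crux K2′;
* `liZeroTailEcho_of_silent`: **`LiZeroTailSilent → LiZeroTailEcho` with NO Fejér hypothesis** — difference the two cuts
  `√n` and `(5/4)√n`: by `TailAdjust.liZeroTail_eq_trace` and Backlund's exact form of the Riemann–von Mangoldt formula
  (`N(T) = θ(T)/π + 1 + S(T)`, `zetaZeroCount_eq_theta_add_zetaArgS`),
  `[tail − smooth](√n) = [tail − smooth](5√n/4) + 2 (S(5√n/4) − S(√n)) − (window − smooth window)(√n, 5√n/4]`,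
  the window term is `−E₂(n) + O(log² n)` by the PROVED round-6 leaf `liZeroWindowEcho_proof` (route LiPrimeEcho), and
  `|S(T)| ≤ 0.3083 log T + 3.24` (`abs_zetaArgS_le_explicit`, PROVED).

Corollaries: `liZeroTailEcho_of_laguerre : LiZeroTailLaguerre → LiZeroTailEcho` (PART K's glue without `LiCoffeyTermFejer`)
and `abs_liCoffeyTerm_two_add_liPrimeEcho_le_of_laguerre` (the leaf forces the Fejér asymptotic of the `m = 2` Coffey term
in the weak form `O(log² n)`).  Nothing here bears on the truth of RH: all statements are RH-free bookkeeping between typed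
RH-free laws; no zero is assumed on the critical line.
-/

noncomputable section

-- D-0017: `Summit.<S>.<S>.…` is the designed namespace of a single-problem summit.
set_option linter.dupNamespace false

open MeasureTheory intervalIntegral Set
open scoped ArithmeticFunction.vonMangoldt

namespace Summit.RiemannHypothesis.RiemannHypothesis.Theorems.LiTheory

open Summit.RiemannHypothesis.RiemannHypothesis.Theses.LiTailLaguerre
open Literature.NumberTheory.LFunctions

namespace SilentEcho

/-! ### Differencing two cuts: the exact identity -/

/-- The zero tails at two cuts `0 ≤ a ≤ b` differ by twice the count minus the windowed Li trace:
`liZeroTail n a − liZeroTail n b = 2 (N(b) − N(a)) − liZeroTraceWindow n a b`. -/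
theorem liZeroTail_sub_eq_count_sub_window (n : ℕ) {a b : ℝ} (ha : 0 ≤ a) (hab : a ≤ b) :
    liZeroTail n a - liZeroTail n b =
      2 * ((zetaZeroCount b : ℝ) - zetaZeroCount a) - liZeroTraceWindow n a b := by
  rw [TailAdjust.liZeroTail_sub_eq, TailAdjust.liZeroTrace_zero_sub_eq ha hab]
  unfold liZeroTraceWindow
  ring

/-- The smooth tails at two cuts `0 < a ≤ b` differ by the theta increment minus the smooth window:
`liSmoothTail n a − liSmoothTail n b = (2/π)(θ(b) − θ(a)) − liSmoothTraceWindow n a b`. -/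
theorem liSmoothTail_sub_eq_theta_sub_window (n : ℕ) {a b : ℝ} (ha : 0 < a) (hab : a ≤ b) :
    liSmoothTail n a - liSmoothTail n b =
      2 / Real.pi * (riemannSiegelTheta b - riemannSiegelTheta a) - liSmoothTraceWindow n a b := by
  rw [TailAdjust.liSmoothTail_sub_eq n ha hab]
  have hϑ : Continuous riemannSiegelThetaDeriv := continuous_riemannSiegelThetaDeriv_holds
  have i0b : IntervalIntegrable riemannSiegelThetaDeriv volume 0 b := hϑ.intervalIntegrable _ _
  have i0a : IntervalIntegrable riemannSiegelThetaDeriv volume 0 a := hϑ.intervalIntegrable _ _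
  have iab : IntervalIntegrable riemannSiegelThetaDeriv volume a b := hϑ.intervalIntegrable _ _
  have icos : IntervalIntegrable (fun t ↦ Real.cos (n * liZeroAngle t) * liGammaDensity t) volume a b :=
    (WindowAdjust.continuousOn_smooth_integrand n ha hab).intervalIntegrable
  have htheta : riemannSiegelTheta b - riemannSiegelTheta a = ∫ t in a..b, riemannSiegelThetaDeriv t := by
    unfold riemannSiegelTheta
    exact intervalIntegral.integral_interval_sub_left i0b i0a
  have hsplit : ∫ t in a..b, liWindowWeight n t * liGammaDensity t =
      (∫ t in a..b, riemannSiegelThetaDeriv t) - ∫ t in a..b, Real.cos (n * liZeroAngle t) * liGammaDensity t := by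
    rw [← intervalIntegral.integral_sub iab icos]
    refine intervalIntegral.integral_congr fun t _ ↦ ?_
    simp only [liWindowWeight, WindowAdjust.liGammaDensity_eq]
    ring
  unfold liSmoothTraceWindow
  rw [hsplit, htheta]
  ring

/-- **The exact differencing identity.** For `0 < a ≤ b`:
`[tail − smooth](a) = [tail − smooth](b) + 2 (S(b) − S(a)) − (liZeroTraceWindow − liSmoothTraceWindow)(a, b]`
(Backlund: `N(T) = θ(T)/π + 1 + S(T)`). -/
theorem tail_sub_smooth_eq (n : ℕ) {a b : ℝ} (ha : 0 < a) (hab : a ≤ b) :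
    liZeroTail n a - liSmoothTail n a =
      (liZeroTail n b - liSmoothTail n b) + 2 * (zetaArgS b - zetaArgS a)
        - (liZeroTraceWindow n a b - liSmoothTraceWindow n a b) := by
  have h1 := liZeroTail_sub_eq_count_sub_window n ha.le hab
  have h2 := liSmoothTail_sub_eq_theta_sub_window n ha hab
  have h3 := zetaZeroCount_eq_theta_add_zetaArgS b
  have h4 := zetaZeroCount_eq_theta_add_zetaArgS a
  have hπ : Real.pi ≠ 0 := Real.pi_ne_zero
  have h2' : Real.pi * (liSmoothTail n a - liSmoothTail n b) =
      2 * (riemannSiegelTheta b - riemannSiegelTheta a) - Real.pi * liSmoothTraceWindow n a b := by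
    rw [h2]; field_simp
  have h3' : Real.pi * (zetaZeroCount b : ℝ) = riemannSiegelTheta b + Real.pi + Real.pi * zetaArgS b := by
    rw [h3]; field_simp
  have h4' : Real.pi * (zetaZeroCount a : ℝ) = riemannSiegelTheta a + Real.pi + Real.pi * zetaArgS a := by
    rw [h4]; field_simp
  have key : Real.pi * (liZeroTail n a - liSmoothTail n a) =
      Real.pi * ((liZeroTail n b - liSmoothTail n b) + 2 * (zetaArgS b - zetaArgS a)
        - (liZeroTraceWindow n a b - liSmoothTraceWindow n a b)) := by
    linear_combination Real.pi * h1 - h2' + 2 * h3' - 2 * h4'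
  exact mul_left_cancel₀ hπ key

/-- `|2 (S(b) − S(a))| ≤ 1.2332 log n + 12.96` for `30 ≤ a ≤ b ≤ n`. -/
theorem abs_two_mul_zetaArgS_sub_le {a b : ℝ} {n : ℕ} (ha : 30 ≤ a) (hab : a ≤ b) (hbn : b ≤ n) :
    |2 * (zetaArgS b - zetaArgS a)| ≤ 1.2332 * Real.log n + 12.96 := by
  have hb : 30 ≤ b := ha.trans hab
  have hSa := abs_zetaArgS_le_explicit ha
  have hSb := abs_zetaArgS_le_explicit hb
  have hla : Real.log a ≤ Real.log n := Real.log_le_log (by linarith) (hab.trans hbn)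
  have hlb : Real.log b ≤ Real.log n := Real.log_le_log (by linarith) hbn
  rw [abs_le] at hSa hSb ⊢
  constructor <;> nlinarith [hSa.1, hSa.2, hSb.1, hSb.2]

end SilentEcho

/-! ### What the rung buys -/

/-- **TAIL SILENCE from the rung (RH-FREE composition).**  K3′ `LiGammaTailShift` and the BC5 rung statement of K2′
(`Sig.stub_rung_silent`, spelled out: for `c ≥ 5/4` the prime tail at cuts `T ∈ [c√n, c√n + 1]` is `O(log n)`) give
PART K's companion `LiZeroTailSilent`; the contour identity K1′ (`liTailContour_proof`), the horizontal edge K4′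
(`liTailHorizontal_proof`) and the supports `liPolarTailBound`, `liTailAdjust` are tree theorems.  (Sketch.lean's
composition with the Coffey sum empty.) -/
theorem liZeroTailSilent_of_rung (hD : LiGammaTailShift)
    (hR : ∀ c : ℝ, 5 / 4 ≤ c → ∃ N : ℕ, ∃ C : ℝ, ∀ n : ℕ, N ≤ n → ∀ T : ℝ, c * Real.sqrt n ≤ T →
      T ≤ c * Real.sqrt n + 1 → |liPrimeTail n T| ≤ C * Real.log n) :
    LiZeroTailSilent := by
  intro c hc
  have hc0 : 0 < c := by linarith
  obtain ⟨N₃, C₃, h3⟩ := liPolarTailBound c hc0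
  obtain ⟨N₄, C₄, h4⟩ := hD c hc0
  obtain ⟨N₅, C₅, h5⟩ := hR c hc
  obtain ⟨N₆, C₆, h6⟩ := liTailHorizontal_proof c hc0
  obtain ⟨N₇, C₇, h7⟩ := liTailAdjust c hc0
  obtain ⟨N₀, hN₀⟩ := exists_nat_gt ((c + 1) ^ 2 + 1 / c ^ 2)
  set ℓ : ℝ := Real.log 2 with hℓ_def
  have hℓ : 0 < ℓ := Real.log_pos (by norm_num)
  refine PrimeEchoAssembly.eventually_to_all _ (max (max (max N₄ N₅) (max N₆ N₇)) (max N₃ N₀))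
    ((2 * |C₇| + |C₄| + |C₃| + |C₅|) / ℓ + |C₆|) fun n hn h2 ↦ ?_
  have hn3 : N₃ ≤ n := by omega
  have hn4 : N₄ ≤ n := by omega
  have hn5 : N₅ ≤ n := by omega
  have hn6 : N₆ ≤ n := by omega
  have hn7 : N₇ ≤ n := by omega
  have hnN₀ : (N₀ : ℝ) ≤ n := by exact_mod_cast (show N₀ ≤ n by omega)
  have hc2 : 0 < 1 / c ^ 2 := by positivity
  set s : ℝ := Real.sqrt n with hs_def
  have hs0 : 0 ≤ s := Real.sqrt_nonneg _
  have hs_sq : s ^ 2 = n := Real.sq_sqrt (Nat.cast_nonneg n)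
  have hs1 : c + 1 ≤ s := by
    rw [← Real.sqrt_sq (by linarith : 0 ≤ c + 1)]
    exact Real.sqrt_le_sqrt (by linarith)
  have hsc : 1 / c ≤ s := by
    rw [← Real.sqrt_sq (le_of_lt (one_div_pos.mpr hc0))]
    refine Real.sqrt_le_sqrt ?_
    rw [one_div_pow]
    nlinarith [sq_nonneg (c + 1)]
  have hcs1 : 1 ≤ c * s := by
    have := mul_le_mul_of_nonneg_left hsc hc0.le
    rwa [mul_one_div_cancel hc0.ne'] at this
  have hcsn : c * s + 1 ≤ n := by
    have h1 : (c + 1) * 1 ≤ s * (s - c) := mul_le_mul hs1 (by linarith) zero_le_one hs0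
    nlinarith [h1, hs_sq]
  obtain ⟨T', hT'l, hT'u, hgood, hH⟩ := h6 n hn6 (c * s) le_rfl (by linarith)
  have hid := liTailContour_proof n T' (by omega) (le_trans hcs1 hT'l) hgood
  have hpol := h3 n hn3 T' hT'l (by linarith)
  have hgam := h4 n hn4 T' hT'l (by linarith)
  have hpr := h5 n hn5 T' hT'l hT'u
  obtain ⟨hadjZ, hadjS⟩ := h7 n hn7 T' hT'l hT'u
  have key : liZeroTail n (c * s) - liSmoothTail n (c * s)
      = (liZeroTail n (c * s) - liZeroTail n T') - (liSmoothTail n (c * s) - liSmoothTail n T')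
        + liPolarTail n T' + (liGammaTail n T' - liSmoothTail n T') - liPrimeTail n T'
        + liHorizTail n T' := by
    rw [hid]; ring
  rw [key]
  set L : ℝ := Real.log n with hL_def
  have hLℓ : ℓ ≤ L := Real.log_le_log (by norm_num) (by exact_mod_cast h2)
  have hL0 : 0 ≤ L := hℓ.le.trans hLℓ
  have hL2 : L ≤ L ^ 2 / ℓ := by
    rw [le_div_iff₀ hℓ, sq]; exact mul_le_mul_of_nonneg_left hLℓ hL0
  have b7 : C₇ * L ≤ |C₇| * (L ^ 2 / ℓ) :=
    (mul_le_mul_of_nonneg_right (le_abs_self C₇) hL0).trans (mul_le_mul_of_nonneg_left hL2 (abs_nonneg _))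
  have b3 : C₃ * L ≤ |C₃| * (L ^ 2 / ℓ) :=
    (mul_le_mul_of_nonneg_right (le_abs_self C₃) hL0).trans (mul_le_mul_of_nonneg_left hL2 (abs_nonneg _))
  have b4 : C₄ * L ≤ |C₄| * (L ^ 2 / ℓ) :=
    (mul_le_mul_of_nonneg_right (le_abs_self C₄) hL0).trans (mul_le_mul_of_nonneg_left hL2 (abs_nonneg _))
  have b5 : C₅ * L ≤ |C₅| * (L ^ 2 / ℓ) :=
    (mul_le_mul_of_nonneg_right (le_abs_self C₅) hL0).trans (mul_le_mul_of_nonneg_left hL2 (abs_nonneg _))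
  have b6 : C₆ * L ^ 2 ≤ |C₆| * L ^ 2 := mul_le_mul_of_nonneg_right (le_abs_self C₆) (sq_nonneg _)
  have e : ((2 * |C₇| + |C₄| + |C₃| + |C₅|) / ℓ + |C₆|) * L ^ 2
      = 2 * (|C₇| * (L ^ 2 / ℓ)) + |C₄| * (L ^ 2 / ℓ) + |C₃| * (L ^ 2 / ℓ) + |C₅| * (L ^ 2 / ℓ)
        + |C₆| * L ^ 2 := by
    field_simp
  rw [e]
  rw [abs_le] at hadjZ hadjS hpol hgam hpr hH ⊢
  constructor <;> linarith [hadjZ.1, hadjZ.2, hadjS.1, hadjS.2, hpol.1, hpol.2, hgam.1, hgam.2,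
    hpr.1, hpr.2, hH.1, hH.2]

/-- **TAIL ECHO from TAIL SILENCE (RH-FREE; no Fejér asymptotic needed).**  `LiZeroTailSilent → LiZeroTailEcho`: the
differencing identity `SilentEcho.tail_sub_smooth_eq` at the cuts `√n ≤ (5/4)√n`, tail silence at `c = 5/4`, the PROVED
round-6 window law `liZeroWindowEcho_proof` at `c = 5/4`, and `|S(T)| ≤ 0.3083 log T + 3.24`. -/
theorem liZeroTailEcho_of_silent (h : LiZeroTailSilent) : LiZeroTailEcho := by
  obtain ⟨C₁, hC₁⟩ := h (5 / 4) le_rfl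
  obtain ⟨C₂, hC₂⟩ := liZeroWindowEcho_proof (5 / 4) le_rfl
  refine PrimeEchoAssembly.eventually_to_all _ 900 (C₁ + C₂ + 15) fun n hn h2 ↦ ?_
  set s : ℝ := Real.sqrt n with hs_def
  have hn900 : (900 : ℝ) ≤ n := by exact_mod_cast hn
  have hs30 : 30 ≤ s := by
    have : Real.sqrt 900 = 30 := by
      rw [show (900 : ℝ) = 30 ^ 2 by norm_num]; exact Real.sqrt_sq (by norm_num)
    rw [← this]; exact Real.sqrt_le_sqrt hn900
  have hs0 : 0 < s := by linarith
  have hs_sq : s ^ 2 = n := Real.sq_sqrt (Nat.cast_nonneg n)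
  have hab : s ≤ 5 / 4 * s := by linarith
  have hbn : 5 / 4 * s ≤ n := by nlinarith
  have hid := SilentEcho.tail_sub_smooth_eq n hs0 hab
  have hS := SilentEcho.abs_two_mul_zetaArgS_sub_le hs30 hab hbn
  have hT := hC₁ n h2
  have hW := hC₂ n h2
  have hlog1 : 1 ≤ Real.log n := by
    rw [Real.le_log_iff_exp_le (by linarith)]
    have := Real.exp_one_lt_d9; linarith
  have hlogsq : Real.log n ≤ Real.log n ^ 2 := by nlinarith
  have e : liZeroTail n s - liSmoothTail n s - liPrimeEcho 2 n =
      (liZeroTail n (5 / 4 * s) - liSmoothTail n (5 / 4 * s)) + 2 * (zetaArgS (5 / 4 * s) - zetaArgS s)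
        - (liZeroTraceWindow n s (5 / 4 * s) - liSmoothTraceWindow n s (5 / 4 * s) + liPrimeEcho 2 n) := by
    rw [hid]; ring
  rw [e]
  rw [abs_le] at hS hT hW ⊢
  constructor <;> nlinarith [hS.1, hS.2, hT.1, hT.2, hW.1, hW.2, hlog1, hlogsq]

/-- **Corollary (PART K's glue without the Fejér hypothesis):** the leaf gives the tail echo. -/
theorem liZeroTailEcho_of_laguerre (h : LiZeroTailLaguerre) : LiZeroTailEcho :=
  liZeroTailEcho_of_silent (liZeroTailSilent_of h)

/-- **Corollary (Fejér, weak form, forced by the laws):** under the leaf, the `m = 2` Coffey term IS minus the echo of the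
prime `2` up to `O(log² n)`: `|liCoffeyTerm 2 n + liPrimeEcho 2 n| ≤ C log² n` (the leaf at `c = 1` releases exactly `m = 2`;
compare `LiCoffeyTermFejer`, which asserts `O(n^{−1/4})`). -/
theorem abs_liCoffeyTerm_two_add_liPrimeEcho_le_of_laguerre (h : LiZeroTailLaguerre) :
    ∃ C : ℝ, ∀ n : ℕ, 2 ≤ n → |liCoffeyTerm 2 n + liPrimeEcho 2 n| ≤ C * Real.log n ^ 2 := by
  have hedge : ∀ m : ℕ, 2 ≤ m → (Λ m : ℝ) ≠ 0 → Real.log m ≠ 1 / (1 : ℝ) ^ 2 := by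
    intro m hm _
    rw [one_pow, div_one]
    rcases Nat.lt_or_ge m 3 with h3 | h3
    · have hm2 : m = 2 := by omega
      subst hm2
      have := Real.log_two_lt_d9
      push_cast
      norm_num at this ⊢; linarith
    · have h3' : (3 : ℝ) ≤ m := by exact_mod_cast h3
      have h1 : 1 < Real.log m := by
        refine (Real.lt_log_iff_exp_lt (by positivity)).2 (lt_of_lt_of_le ?_ h3')
        have := Real.exp_one_lt_d9
        norm_num at this ⊢; linarith
      exact ne_of_gt h1
  obtain ⟨C₁, hC₁⟩ := h 1 one_pos hedge
  obtain ⟨C₂, hC₂⟩ := liZeroTailEcho_of_laguerre h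
  refine ⟨C₁ + C₂, fun n hn ↦ ?_⟩
  have k1 := hC₁ n hn
  rw [one_mul, floor_exp_one_div_one_sq, Finset.Icc_self, Finset.sum_singleton] at k1
  have k2 := hC₂ n hn
  calc |liCoffeyTerm 2 n + liPrimeEcho 2 n|
      = |(liZeroTail n (Real.sqrt n) - liSmoothTail n (Real.sqrt n) + liCoffeyTerm 2 n)
          - (liZeroTail n (Real.sqrt n) - liSmoothTail n (Real.sqrt n) - liPrimeEcho 2 n)| := by ring_nf
    _ ≤ |liZeroTail n (Real.sqrt n) - liSmoothTail n (Real.sqrt n) + liCoffeyTerm 2 n|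
          + |liZeroTail n (Real.sqrt n) - liSmoothTail n (Real.sqrt n) - liPrimeEcho 2 n| := abs_sub _ _
    _ ≤ C₁ * Real.log n ^ 2 + C₂ * Real.log n ^ 2 := add_le_add k1 k2
    _ = (C₁ + C₂) * Real.log n ^ 2 := by ring

end Summit.RiemannHypothesis.RiemannHypothesis.Theorems.LiTheory

end
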